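import Summits.AtomisticToContinuum.Crystallization.Theorems.LoopTunnelDialCalibratorRungSeats
import Summits.AtomisticToContinuum.Crystallization.Theorems.LoopTunnelDialShellTail

/-!
# LoopTunnelDial — the SURFACE CALIBRATOR (kit 13): the void axis of crux `PocketCase` closed at finite order
# (decomp-a2c lens-5 «finite/base range + asymptotic regime + bridge», generation 25; stmt-AtomisticToContinuum-27294,
# `--supports stmt-AtomisticToContinuum-27294 --as helper`)

Kit 12 (`LoopTunnelDialCalibratorRung`, `…Seats`, landed p811172/p811179) ELIMINATED the chemical potential from the near floor: a
μ-rigid configuration carries no CALIBRATED void — no family of `k` admissible hole points whose fill gain reaches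
`k·(1/100 − 𝓔^m) + 1/50` for some particle `m` (Kossel's half-crystal rule of order `k`).  What was left on the void axis (critic row 342,
texture (iii)) is a SURFACE statement: sealed cavities survive only in clusters EVERY particle of which over-binds.  This file types the
hypothesis that kills (iii) — HOST-LIKENESS OF ONE VERTEX PATCH, `H_surf` — with every constant explicit and `e⋆`-free, proves the
SURFACE CALIBRATOR it yields, and proves the closure «surface calibrator ⟹ no rich void at a μ-rigid configuration» at EVERY order `k`,
EVERY test radius, EVERY index and EVERY level.

* §1 `H_surf`, explicit.  `HostTemplate Θ T`: a centrosymmetric finite star `T ⊂ ℝ³` of vectors of length `≥ 9/10` with HALF-SUM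
  `(1/2)·Σ_{v ∈ T} V(|v|) ≥ −Θ`.  `VertexPatchOn T ρ y m`: within range `ρ` every neighbour vector of `m` is a template vector and `m` is a
  VERTEX of its `ρ`-patch (no two neighbour vectors within `ρ` antipodal).  `HostLikeVertexPatch ρ Θ y m := ∃ T, HostTemplate Θ T ∧
  VertexPatchOn T ρ y m` (= `H_surf` at `m`).  For the fcc host at its own spacing the star of lattice vectors of length `≤ ρ` is a template with
  `Θ_fcc(ρ) ↑ |e_loc| = 0.7173` (`0.655 (ρ = 2)`, `0.708 (4)`, `0.7151 (6)`, `0.7165 (8)`, `0.7172 (12)`; float, lens-5 g25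
  `num/surface_calibrator_reach.out`), and every on-lattice particle at a convex-hull vertex of an fcc crystallite carries it.
* §2 DISCLOSURE (`hostLikeVertexPatch_iff`): in configuration terms `H_surf(ρ, Θ)` at `m` says EXACTLY «`m` is a `ρ`-vertex, its `ρ`-patch is
  `9/10`-clear, and `m` binds at most `Θ` from within `ρ`» — Kossel's half-environment principle (kit 12 §6) is the proof that host-like vertex
  patches have `Θ = Θ_host(ρ)`; nothing is hidden in the template.  Every `9/10`-clear `ρ`-vertex is host-like at the crude level `#patch/12`
  (`hostLikeVertexPatch_of_vertex`), and every nonempty injective configuration HAS a `ρ`-vertex (`exists_vertexWithin`, from kit 12's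
  `exists_antipodalFree`): the load-bearing clause of `H_surf` is the binding level `Θ`, not the geometry.
* §3 THE SURFACE CALIBRATOR `SurfaceCalibrator ρ Θ E`: every injective `7/10`-separated configuration with ONE host-like vertex patch
  `(ρ, Θ)` has a particle with `𝓔^m ≥ −(Θ + E)` — PROVED from any certified far tail `FarTails ρ E F` (`surfaceCalibrator_of_farTails`; tree
  instances `tailE ρ` and the integer-shell tail `τₙ/6`, numerals `SurfaceCalibrator 8 Θ (Θ-free tail 17/300)`).
* §4 CLOSURE — NO RICH VOID: at an `(e, 1/(j+1), j)`-μ-stable configuration (`j ≥ 100`, ANY level `e`) with a host-like vertex patch, every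
  admissible hole family of order `k ≤ j` has fill gain `< k·(Θ + E + 1/100) + 1/50` (`fillGain_lt_of_muStable_patch`); sequence seat
  `rigid_richVoid_seat` (the line's `RigidNearPocket0` on the class «rich void ∧ host-like vertex patch», `∀ R ≥ 1 ∀ e ∃ j₀`); floor form
  `improvable_of_richVoid_patch` / `richVoid_floor` (GS reading: a rich void next to a host-like vertex patch is a radius-`R` improvement by `1/100`).
* §5 THE NAMED RESIDUAL.  `SurfaceFrustrated ρ Θ y := ∀ m, ¬ HostLikeVertexPatch ρ Θ y m` — «TETRAHEDRAL FRUSTRATION AT THE FREE SURFACE»: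
  by §2 it reads «every `9/10`-clear `ρ`-vertex of the cluster binds MORE than `Θ` from within `ρ`» (`surfaceFrustrated_iff`), the surface form of
  the catalogued barrier `Literature.Barriers.AtomisticToContinuum.TetrahedralFrustration` / `…IcosahedralClusters` (which type the bulk
  obstruction only; no surface case exists in the tree, hence this one-line definition).  DICHOTOMY OF RECORD (`surfaceFrustrated_or_noRichVoid`):
  a μ-rigid configuration is `(ρ, Θ)`-surface-frustrated OR carries no `(Θ + E)`-rich void of any order within any `R`.
* §6 WITNESSES (the class `H_surf` is inhabited, 0 sorry): the dimer (`Θ = 1/12`) and the fcc CORNER patch — a site with three mutually adjacent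
  neighbours of the `(1,1,0)` family (`Θ = 1/4` crude; exact `15/256`).

REACH (float, g25 `num/surface_calibrator_reach.out`; tree units `V(1) = −1/12`).  Level of the calibrator with the fcc template:
`L(ρ) = Θ_fcc(ρ) + τ_ρ/6 = 0.772 (ρ = 8)`, `0.749 (10)`, `0.7375 (12)`, `→ |e_loc| = 0.7173`.  A cavity `K` of order `k` in the host is
`L`-RICH iff `G(K)/k − 1/100 − 1/(50k) ≥ L`; host ball cavities have `G/k = 1.43 (k = 1)`, `1.17 (13)`, `1.03 (55)`, `0.94 (177)`, `0.89 (381)`,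
`≈ |e_loc| + 1.07·k^{-1/3}` — so EVERY host cavity of order `k ≤ k₀(ρ) ≈ 4.6·10³ (ρ = 8)`, `4.5·10⁴ (12)`, `2.9·10⁵ (20)`, `→ 1.2·10⁶` is excluded
next to one host-like vertex patch: the FINITE RANGE of the lens.  The ASYMPTOTIC REGIME — cavities of unbounded order, whose per-site concavity
bonus `1.07·k^{-1/3}` falls under the margin `1/100` — is NOT surface physics but COHESION (lens-6 crux `Cohesion`, stmt-AtomisticToContinuum-24040,
by name); the BRIDGE is kit 12's μ-seat.  The critic's tentative level `|e_loc| − 1/100 = 0.7073` is NOT certified by host-likeness (a kink =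
half-crystal particle binds exactly `|e_loc|`; vicinal half-space clusters have no looser particle), which is why the margin is charged to the
cavity (richness) and not to the surface; on every computed fcc crystallite (balls `N ≤ 2171`, cubes, octahedra) the loosest particle binds
`0.36–0.69 < 0.7073` anyway (coordination `3–6`).

Every `def` below is line vocabulary of the LoopTunnelDial contact dial (crux stmt-AtomisticToContinuum-27294), not a cited fact; all results
`[folklore]`-level bookkeeping over kit 12 + the landed tails.  Imports only landed modules.  0 sorry.
-/

open scoped BigOperators Classical Topology
open Filter
open Literature.MathematicalPhysics.StatisticalMechanics
open Summit.AtomisticToContinuum.Crystallization.Theorems.GrainPercolationDialCrossCeiling (E3)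
open Summit.AtomisticToContinuum.Crystallization.Theorems.LoopTunnelDialLocalSurgery
open Summit.AtomisticToContinuum.Crystallization.Theorems.LoopTunnelDialVoidRung
open Summit.AtomisticToContinuum.Crystallization.Theorems.LoopTunnelDialRangeTails
open Summit.AtomisticToContinuum.Crystallization.Theorems.LoopTunnelDialShellTail
open Summit.AtomisticToContinuum.Crystallization.Theorems.LoopTunnelDialCalibratorRung

namespace Summit.AtomisticToContinuum.Crystallization.Theorems.LoopTunnelDialSurfaceCalibrator

variable {N : ℕ}

/-! ## §1 The hypothesis `H_surf`, explicit -/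

/-- **HOST TEMPLATE** of half-binding `Θ`: a centrosymmetric finite star of vectors of length `≥ 9/10` whose half-sum of pair energies is
`≥ −Θ`.  (fcc star of range `ρ` at its own spacing: `Θ_fcc(ρ) ↑ |e_loc| = 0.7173`.) -/
def HostTemplate (Θ : ℝ) (T : Finset E3) : Prop :=
  (∀ v ∈ T, -v ∈ T) ∧ (∀ v ∈ T, (9 : ℝ) / 10 ≤ ‖v‖) ∧ -Θ ≤ (1 / 2) * ∑ v ∈ T, lennardJones ‖v‖

/-- **VERTEX PATCH ON A TEMPLATE:** within range `ρ` every neighbour vector of `m` is a template vector, and `m` is a VERTEX of its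
`ρ`-patch — no two of its neighbour vectors within `ρ` are antipodal. -/
def VertexPatchOn (T : Finset E3) (ρ : ℝ) (y : Fin N → E3) (m : Fin N) : Prop :=
  (∀ l : Fin N, l ≠ m → dist (y m) (y l) ≤ ρ → y l - y m ∈ T) ∧
    ∀ l l' : Fin N, l ≠ m → l' ≠ m → dist (y m) (y l) ≤ ρ → dist (y m) (y l') ≤ ρ → y l - y m ≠ -(y l' - y m)

/-- **`H_surf(ρ, Θ)` at `m` — a HOST-LIKE VERTEX PATCH:** some host template of half-binding `Θ` carries the `ρ`-patch of `m` as a vertex patch. -/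
def HostLikeVertexPatch (ρ Θ : ℝ) (y : Fin N → E3) (m : Fin N) : Prop :=
  ∃ T : Finset E3, HostTemplate Θ T ∧ VertexPatchOn T ρ y m

/-- **SURFACE FRUSTRATION `(ρ, Θ)` — «TetrahedralFrustration at the free surface»:** NO particle carries a host-like vertex patch; by
`surfaceFrustrated_iff`, every `9/10`-clear `ρ`-vertex binds more than `Θ` from within `ρ`.  The surface form of the catalogued bulk barrier
`Literature.Barriers.AtomisticToContinuum.TetrahedralFrustration` (and `…IcosahedralClusters`), which has no surface case in the tree. -/
def SurfaceFrustrated (ρ Θ : ℝ) (y : Fin N → E3) : Prop :=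
  ∀ m : Fin N, ¬ HostLikeVertexPatch ρ Θ y m

/-- **THE SURFACE CALIBRATOR `(ρ, Θ, E)`:** every injective `7/10`-separated configuration with ONE host-like vertex patch `(ρ, Θ)` has a
particle bound by at most `Θ + E`: `𝓔^m ≥ −(Θ + E)`. -/
def SurfaceCalibrator (ρ Θ E : ℝ) : Prop :=
  ∀ (N : ℕ) (y : Fin N → E3), Function.Injective y → (∀ i j : Fin N, i ≠ j → (7 : ℝ) / 10 ≤ dist (y i) (y j)) →
    (∃ m : Fin N, HostLikeVertexPatch ρ Θ y m) → ∃ m : Fin N, -(Θ + E) ≤ siteEnergy lennardJones y m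

/-! ## §2 Disclosure: what `H_surf` says in configuration terms -/

/-- Membership in the near index set. -/
theorem mem_nearIdx_iff {ρ : ℝ} {y : Fin N → E3} {m l : Fin N} : l ∈ nearIdx ρ y m ↔ l ≠ m ∧ dist (y m) (y l) ≤ ρ := by
  unfold nearIdx
  rw [Finset.mem_filter, Finset.mem_erase]
  simp

/-- The near part of the site energy as a sum over the near NEIGHBOUR VECTORS. -/
theorem nearSum_eq_sum_image {ρ : ℝ} {y : Fin N → E3} (hy : Function.Injective y) (m : Fin N) :
    ∑ l ∈ nearIdx ρ y m, lennardJones (dist (y m) (y l)) =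
      ∑ v ∈ (nearIdx ρ y m).image (fun l => y l - y m), lennardJones ‖v‖ := by
  have hinjv : Set.InjOn (fun l => y l - y m) ↑(nearIdx ρ y m) := fun l _ l' _ h => hy (sub_left_injective h)
  rw [Finset.sum_image hinjv]
  exact Finset.sum_congr rfl fun l _ => by rw [dist_eq_norm, ← norm_neg, neg_sub]

/-- **DISCLOSURE (PROVED): `H_surf(ρ, Θ)` at `m` ⟺ `m` is a `ρ`-vertex, its `ρ`-patch is `9/10`-clear, and `m` binds at most `Θ` from
within `ρ`.**  (⟹ is Kossel's half-environment principle of kit 12; ⟸ takes the template `S ∪ −S`, `S` = the near neighbour vectors.) -/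
theorem hostLikeVertexPatch_iff {ρ Θ : ℝ} {y : Fin N → E3} (hy : Function.Injective y) (m : Fin N) :
    HostLikeVertexPatch ρ Θ y m ↔
      (∀ l l' : Fin N, l ≠ m → l' ≠ m → dist (y m) (y l) ≤ ρ → dist (y m) (y l') ≤ ρ → y l - y m ≠ -(y l' - y m)) ∧
        (∀ l : Fin N, l ≠ m → dist (y m) (y l) ≤ ρ → 9 / 10 ≤ dist (y m) (y l)) ∧
        -Θ ≤ ∑ l ∈ nearIdx ρ y m, lennardJones (dist (y m) (y l)) := by
  set S : Finset E3 := (nearIdx ρ y m).image (fun l => y l - y m) with hS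
  have hmemS : ∀ v, v ∈ S ↔ ∃ l, (l ≠ m ∧ dist (y m) (y l) ≤ ρ) ∧ y l - y m = v := fun v => by
    rw [hS, Finset.mem_image]
    simp only [mem_nearIdx_iff]
  constructor
  · rintro ⟨T, ⟨hT, hTfar, hΘ⟩, henv, hanti⟩
    refine ⟨hanti, fun l hl hd => ?_, ?_⟩
    · have h := hTfar _ (henv l hl hd)
      rwa [← dist_eq_norm, dist_comm] at h
    · have hST : S ⊆ T := by
        intro v hv
        obtain ⟨l, ⟨hl, hd⟩, rfl⟩ := (hmemS v).1 hv
        exact henv l hl hd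
      have hSanti : ∀ v ∈ S, -v ∉ S := by
        intro v hv hv'
        obtain ⟨l', ⟨hl', hd'⟩, rfl⟩ := (hmemS v).1 hv
        obtain ⟨l, ⟨hl, hd⟩, hle⟩ := (hmemS _).1 hv'
        exact hanti l l' hl hl' hd hd' hle
      have hcore := half_sum_le_of_antipodalFree hT hTfar hST hSanti
      rw [nearSum_eq_sum_image hy m]
      linarith
  · rintro ⟨hanti, hclear, hbind⟩
    set S' : Finset E3 := S.image fun v => -v with hS'
    have hmemS' : ∀ w, w ∈ S' ↔ -w ∈ S := fun w => by
      rw [hS', Finset.mem_image]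
      constructor
      · rintro ⟨v, hv, rfl⟩
        rwa [neg_neg]
      · intro hw
        exact ⟨-w, hw, neg_neg w⟩
    have hSfar : ∀ v ∈ S, (9 : ℝ) / 10 ≤ ‖v‖ := by
      intro v hv
      obtain ⟨l, ⟨hl, hd⟩, rfl⟩ := (hmemS v).1 hv
      have h := hclear l hl hd
      rwa [dist_comm, dist_eq_norm] at h
    have hdisj : Disjoint S S' := by
      rw [Finset.disjoint_left]
      intro w hw hw'
      rw [hmemS'] at hw'
      obtain ⟨l', ⟨hl', hd'⟩, rfl⟩ := (hmemS w).1 hw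
      obtain ⟨l, ⟨hl, hd⟩, hle⟩ := (hmemS _).1 hw'
      exact hanti l' l hl' hl hd' hd (by rw [hle, neg_neg])
    have hsumS' : ∑ w ∈ S', lennardJones ‖w‖ = ∑ v ∈ S, lennardJones ‖v‖ := by
      rw [hS', Finset.sum_image (fun v _ v' _ h => neg_injective h)]
      simp only [norm_neg]
    refine ⟨S ∪ S', ⟨?_, ?_, ?_⟩, ?_, hanti⟩
    · intro v hv
      rcases Finset.mem_union.1 hv with h | h
      · exact Finset.mem_union_right _ ((hmemS' _).2 (by rwa [neg_neg]))
      · exact Finset.mem_union_left _ ((hmemS' _).1 h)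
    · intro v hv
      rcases Finset.mem_union.1 hv with h | h
      · exact hSfar v h
      · have h' := hSfar _ ((hmemS' _).1 h)
        rwa [norm_neg] at h'
    · rw [Finset.sum_union hdisj, hsumS', ← nearSum_eq_sum_image hy m]
      linarith
    · intro l hl hd
      exact Finset.mem_union_left _ ((hmemS _).2 ⟨l, ⟨hl, hd⟩, rfl⟩)

/-- **Every `9/10`-clear `ρ`-vertex is host-like at the crude level `#patch/12` (PROVED)** — `V_LJ ≥ −1/12`; the load-bearing clause of
`H_surf` is the LEVEL `Θ`, not the geometry. -/
theorem hostLikeVertexPatch_of_vertex {ρ : ℝ} {y : Fin N → E3} (hy : Function.Injective y) (m : Fin N)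
    (hanti : ∀ l l' : Fin N, l ≠ m → l' ≠ m → dist (y m) (y l) ≤ ρ → dist (y m) (y l') ≤ ρ → y l - y m ≠ -(y l' - y m))
    (hclear : ∀ l : Fin N, l ≠ m → dist (y m) (y l) ≤ ρ → 9 / 10 ≤ dist (y m) (y l)) :
    HostLikeVertexPatch ρ (((nearIdx ρ y m).card : ℝ) / 12) y m := by
  rw [hostLikeVertexPatch_iff hy m]
  refine ⟨hanti, hclear, ?_⟩
  have h := Finset.card_nsmul_le_sum (nearIdx ρ y m) (fun l => lennardJones (dist (y m) (y l))) (-1 / 12)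
    (fun l _ => neg_one_div_le_lennardJones _)
  rw [nsmul_eq_mul] at h
  linarith

/-- **Every nonempty injective configuration has a `ρ`-vertex, for every `ρ` (PROVED)** — kit 12's `exists_antipodalFree` (a particle
farthest from the origin). -/
theorem exists_vertexWithin (hN : 0 < N) (y : Fin N → E3) (hy : Function.Injective y) (ρ : ℝ) :
    ∃ m : Fin N, ∀ l l' : Fin N, l ≠ m → l' ≠ m → dist (y m) (y l) ≤ ρ → dist (y m) (y l') ≤ ρ →
      y l - y m ≠ -(y l' - y m) := by
  obtain ⟨m, hm⟩ := exists_antipodalFree hN y hy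
  exact ⟨m, fun l l' hl hl' _ _ => hm l l' hl hl'⟩

/-- **SURFACE FRUSTRATION, EXPANDED (PROVED):** `SurfaceFrustrated ρ Θ y` ⟺ every `9/10`-clear `ρ`-vertex of `y` binds MORE than `Θ`
from within `ρ`. -/
theorem surfaceFrustrated_iff {ρ Θ : ℝ} {y : Fin N → E3} (hy : Function.Injective y) :
    SurfaceFrustrated ρ Θ y ↔ ∀ m : Fin N,
      (∀ l l' : Fin N, l ≠ m → l' ≠ m → dist (y m) (y l) ≤ ρ → dist (y m) (y l') ≤ ρ → y l - y m ≠ -(y l' - y m)) →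
        (∀ l : Fin N, l ≠ m → dist (y m) (y l) ≤ ρ → 9 / 10 ≤ dist (y m) (y l)) →
          ∑ l ∈ nearIdx ρ y m, lennardJones (dist (y m) (y l)) < -Θ := by
  unfold SurfaceFrustrated
  refine forall_congr' fun m => ?_
  rw [hostLikeVertexPatch_iff hy m]
  constructor
  · intro h hanti hclear
    by_contra hlt
    exact h ⟨hanti, hclear, not_lt.1 hlt⟩
  · rintro h ⟨hanti, hclear, hbind⟩
    exact absurd hbind (not_le.2 (h hanti hclear))

/-! ## §3 The surface calibrator from a certified far tail -/

/-- **KOSSEL AT FINITE RANGE WITH A GENERAL TAIL (PROVED):** kit 12's `half_sub_tail_le_siteEnergy_of_antipodalFree_near` with the tree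
tail `tailE ρ` replaced by any certified `FarTails ρ E F`: `(1/2)·Σ_{v ∈ T} V(|v|) − E ≤ 𝓔^m(y)`. -/
theorem half_sub_le_siteEnergy_of_farTails {ρ E F : ℝ} (hFT : FarTails ρ E F) {y : Fin N → E3} (hy : Function.Injective y)
    (hsep : ∀ i j : Fin N, i ≠ j → (7 : ℝ) / 10 ≤ dist (y i) (y j)) (m : Fin N)
    (T : Finset E3) (hT : ∀ v ∈ T, -v ∈ T) (hTfar : ∀ v ∈ T, 9 / 10 ≤ ‖v‖)
    (henv : ∀ l : Fin N, l ≠ m → dist (y m) (y l) ≤ ρ → y l - y m ∈ T)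
    (hanti : ∀ l l' : Fin N, l ≠ m → l' ≠ m → dist (y m) (y l) ≤ ρ → dist (y m) (y l') ≤ ρ →
      y l - y m ≠ -(y l' - y m)) :
    (1 / 2) * ∑ v ∈ T, lennardJones ‖v‖ - E ≤ siteEnergy lennardJones y m := by
  have hsplit : siteEnergy lennardJones y m =
      ∑ l ∈ nearIdx ρ y m, lennardJones (dist (y m) (y l)) + ∑ l ∈ farIdx ρ y m, lennardJones (dist (y m) (y l)) := by
    unfold siteEnergy
    exact sum_erase_eq_near_add_far ρ y m _
  have hfar : -E ≤ ∑ l ∈ farIdx ρ y m, lennardJones (dist (y m) (y l)) := by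
    have h := (hFT N y hy hsep m).1
    have h' : -(∑ l ∈ farIdx ρ y m, |lennardJones (dist (y m) (y l))|) ≤
        ∑ l ∈ farIdx ρ y m, lennardJones (dist (y m) (y l)) := by
      rw [← Finset.sum_neg_distrib]
      exact Finset.sum_le_sum fun l _ => neg_abs_le _
    linarith
  -- near part `≥ −Θ`-type bound through the disclosure
  have hpatch : HostLikeVertexPatch ρ (-((1 / 2) * ∑ v ∈ T, lennardJones ‖v‖)) y m :=
    ⟨T, ⟨hT, hTfar, by rw [neg_neg]⟩, henv, hanti⟩
  obtain ⟨-, -, hnear⟩ := (hostLikeVertexPatch_iff hy m).1 hpatch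
  rw [neg_neg] at hnear
  rw [hsplit]
  linarith

/-- **THE SURFACE CALIBRATOR FROM ANY CERTIFIED TAIL (PROVED):** `FarTails ρ E F ⟹ SurfaceCalibrator ρ Θ E`. -/
theorem surfaceCalibrator_of_farTails {ρ Θ E F : ℝ} (hFT : FarTails ρ E F) : SurfaceCalibrator ρ Θ E := by
  rintro N y hy hsep ⟨m, T, ⟨hT, hTfar, hΘ⟩, henv, hanti⟩
  have h := half_sub_le_siteEnergy_of_farTails hFT hy hsep m T hT hTfar henv hanti
  exact ⟨m, by linarith⟩

/-- The calibrator is monotone in the tail. -/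
theorem surfaceCalibrator_mono {ρ Θ E E' : ℝ} (hE : E ≤ E') (h : SurfaceCalibrator ρ Θ E) : SurfaceCalibrator ρ Θ E' := by
  intro N y hy hsep hpatch
  obtain ⟨m, hm⟩ := h N y hy hsep hpatch
  exact ⟨m, by linarith⟩

/-- **Tree instance:** `SurfaceCalibrator ρ Θ (tailE ρ)` for `ρ ≥ 1` (`tailE ρ = 72·(10/7)³·ρ⁻³`). -/
theorem surfaceCalibrator_tree {ρ : ℝ} (hρ : 1 ≤ ρ) (Θ : ℝ) : SurfaceCalibrator ρ Θ (tailE ρ) :=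
  surfaceCalibrator_of_farTails (farTails_tree hρ)

/-- **Integer-shell instance:** `SurfaceCalibrator n Θ (τₙ/6)` for `n ≥ 2`. -/
theorem surfaceCalibrator_shells {n : ℕ} (hn : 2 ≤ n) (Θ : ℝ) : SurfaceCalibrator n Θ (1 / 6 * tauShell n) :=
  surfaceCalibrator_of_farTails (farTails_shells hn)

/-- **Reach numeral at range `8`:** `SurfaceCalibrator 8 Θ (17/300)` (`τ₈/6 < 0.0567`; with the fcc template `Θ_fcc(8) = 0.7165` the level is
`< 0.7732`). -/
theorem surfaceCalibrator_eight (Θ : ℝ) : SurfaceCalibrator 8 Θ (17 / 300) := by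
  have h := surfaceCalibrator_shells (by norm_num : 2 ≤ 8) Θ
  have h8 : (1 : ℝ) / 6 * tauShell 8 ≤ 17 / 300 := by have := tauShell_eight_lt; linarith
  exact surfaceCalibrator_mono h8 (by exact_mod_cast h)

end Summit.AtomisticToContinuum.Crystallization.Theorems.LoopTunnelDialSurfaceCalibrator
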